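import Summits.CriticalPhenomena.SAWScalingLimit.Theses.SAWRenewalTightness
import Summits.CriticalPhenomena.SAWScalingLimit.Theorems.SAWRenewalTightnessShellCrossingBoundSocketTransfer
import Summits.CriticalPhenomena.SAWScalingLimit.Theorems.SubseqIdentification.Negative.ProbabilityRedundant
import Literature.Probability.RandomPlanarGeometry.ConformalRestrictionProofs
import HarnessLib

/-!
# `ShellCrossingBound`, line `pinch-on-a-circle`, stub E: calibration against the summit conjunct

Crux item `stmt-CriticalPhenomena-4728` (`SAWRenewalTightness.ShellCrossingBound`), registered
helper `confinementPositivity_of_scalingLimit` for the OPEN stub E `stub_confinementPositivity`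
("confinement positivity", `ConfinementPositivity` of the line skeleton
`Lines/pinch-on-a-circle.lean`): for socketed Jordan pairs `D' ⊆ D` (same marked points
`a = pt 0`, `b = pt 1`; `D ∩ (B(a, d) ∪ B(b, d)) ⊆ D'`) the critical SAW of the BIG domain `D`
from `a_δ` to `b_δ` is, with probability `≥ c > 0` uniformly in small `δ`, (the support of) a
walk of the small discrete domain `D'_δ`.

This file does NOT prove E.  It certifies, kernel-checked, that E is IMPLIED by the summit
conjunct `SAWScalingLimit` (the critical SAW converges in law to chordal SLE_{8/3}) together with
the positivity of hull avoidance for the chordal SLE_{8/3} law (`P[γ ⊆ (cl (D ∖ D'))ᶜ] > 0` for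
hull subdomains `D'` of `D`), BOTH taken as hypotheses: so E is not refutable short of refuting
one of them.  Everything proved here is unconditional glue:

* (A) the marked points lie off `cl (D ∖ D')` (the socket balls are open neighbourhoods of the
  marked points disjoint from `D ∖ D'`);
* (B) the LATTICE LEMMA `ConfinementCalib.exists_domainSAW_of_curve_mem_rangeSubset`: a SAW of
  `D_δ` whose polyline stays in the open set `U := (cl (D ∖ D'))ᶜ` is, with the same support, a
  SAW of `D'_δ` as soon as its endpoints are joined in `D'_δ` (vertices on the polyline lie in
  `D ∩ U ⊆ D'`; closed edge segments lie in `cl D ∩ U ⊆ cl D'`; all vertices are joined to the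
  first one inside the mesh graph of `D'`, and `D'_δ` is a union of whole mesh components,
  `mem_meshDomain_of_reachable_meshVertexGraph`; then `SimpleGraph.Walk.transfer`);
* (C) an endpoint approximation of `D'` is one of `D` (nesting of the discrete domains,
  `JordanDomain.exists_forall_meshDomain_subset`, `exists_domainSAW_of_meshDomain_subset`);
* (D) PORTMANTEAU: the pushed SAW laws (probability measures for small `δ`,
  `SubseqIdentification.Negative.eventually_isProbabilityMeasure_law`) converge weakly to the
  SLE_{8/3} law `μ`, a probability measure (test function `f ≡ 1`), so for the OPEN event
  `G := rangeSubset U` (`CurveClass.isOpen_rangeSubset`) `μ G ≤ liminf_δ P_δ(curve ∈ G)`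
  (`ProbabilityMeasure.le_liminf_measure_open_of_tendsto`), whence `P_δ(curve ∈ G) > μ G / 2`
  for all small `δ`, and `{curve ∈ G} ⊆ {γ is a D'_δ-walk}` by (B).

Folklore; no new named fact.  Mathlib anchors:
`ProbabilityMeasure.le_liminf_measure_open_of_tendsto`,
`ProbabilityMeasure.tendsto_iff_forall_integral_tendsto`, `Filter.eventually_lt_of_lt_liminf`,
`Filter.HasBasis.eventually_iff` with `nhdsGT_basis`, `MeasureTheory.Measure.map_apply`,
`SimpleGraph.Walk.transfer`, `mem_closure_iff_nhds`, `closure_union`.  H21 anchors: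
`CurveClass.isOpen_rangeSubset` (`ConformalRestrictionProofs.lean`), `IsSLECurve.isSLELaw_map`,
`TendstoLaw`, `SAW.aemeasurable_curve`, `range_toCurve_cons_eq`
(`…ShellCrossingBoundSocketTransfer.lean`), `mem_meshDomain_of_reachable_meshVertexGraph`
(`MeshDomainBigComponents.lean`), `eventually_isProbabilityMeasure_law`
(`SubseqIdentification/Negative/ProbabilityRedundant.lean`).
-/

noncomputable section

namespace Summit.CriticalPhenomena.SAWScalingLimit.Theorems

open MeasureTheory Set Metric Filter Topology
open scoped ENNReal NNReal
open Literature.Probability.RandomPlanarGeometry Literature.Probability.LatticeModels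

/-! ### (B) The lattice lemma: a `D_δ`-walk whose polyline avoids `cl (D ∖ D')` is a `D'_δ`-walk -/

section Lattice

variable {Ω Ω' : Set ℂ} {δ : ℝ}

/-- A point of `cl Ω` off `cl (Ω ∖ Ω')` lies in `cl Ω'` (`Ω ⊆ (Ω ∖ Ω') ∪ Ω'` and
`closure_union`). [folklore] -/
theorem ConfinementCalib.mem_closure_of_notMem_closure_diff {z : ℂ} (hz : z ∈ closure Ω)
    (hz' : z ∉ closure (Ω \ Ω')) : z ∈ closure Ω' := by
  have h : closure Ω ⊆ closure (Ω \ Ω') ∪ closure Ω' := by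
    rw [← closure_union]
    exact closure_mono (Set.subset_sdiff_union Ω Ω')
  exact (h hz).resolve_left hz'

/-- A vertex joined in `Ω_δ` to a different vertex lies in the discrete domain `meshDomain Ω δ`
(the first edge of a joining walk). [folklore] -/
theorem ConfinementCalib.mem_meshDomain_of_reachable_of_ne {u v : Site 2}
    (h : (discreteDomainGraph Ω δ).Reachable u v) (huv : u ≠ v) : u ∈ meshDomain Ω δ := by
  obtain ⟨p⟩ := h
  cases p with
  | nil => exact absurd rfl huv
  | cons hadj _ => exact (discreteDomainGraph_adj_iff.1 hadj).2.1

/-- **Edges of a confined walk are edges of the small discrete domain.** If a walk of `Ω_δ`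
starts at a vertex of `Ω'_δ = meshDomain Ω' δ` and its polyline stays off `cl (Ω ∖ Ω')`, all its
edges are edges of `Ω'_δ`: by induction along the walk, each edge segment `[δx, δy]` lies in
`cl Ω` off `cl (Ω ∖ Ω')`, hence in `cl Ω'` (a mesh edge of `Ω'`); its far end `δy ∈ Ω` lies off
`Ω ∖ Ω'`, hence in `Ω'` (a mesh vertex of `Ω'`), and is joined to `x ∈ Ω'_δ` by that mesh edge,
hence lies in `Ω'_δ` (`mem_meshDomain_of_reachable_meshVertexGraph`). [folklore] -/
theorem ConfinementCalib.forall_mem_edges_mem_edgeSet {x v : Site 2}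
    (p : (discreteDomainGraph Ω δ).Walk x v) (hx : x ∈ meshDomain Ω' δ)
    (hr : Set.range (p.toCurve (meshPoint δ)) ⊆ (closure (Ω \ Ω'))ᶜ) :
    ∀ e ∈ p.edges, e ∈ (discreteDomainGraph Ω' δ).edgeSet := by
  induction p with
  | nil => simp
  | @cons x y w h q ih =>
    rw [range_toCurve_cons_eq] at hr
    obtain ⟨hseg, hq⟩ := Set.union_subset_iff.1 hr
    obtain ⟨hmesh, -, hyD⟩ := discreteDomainGraph_adj_iff.1 h
    obtain ⟨hzd, hsegΩ⟩ := meshGraph_adj_iff.1 hmesh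
    -- the edge is a mesh edge of `Ω'`
    have hmesh' : (meshGraph Ω' δ).Adj x y :=
      meshGraph_adj_iff.2 ⟨hzd, fun z hz =>
        ConfinementCalib.mem_closure_of_notMem_closure_diff (hsegΩ hz) (hseg hz)⟩
    -- its far end is a mesh vertex of `Ω'`
    have hyΩ : meshPoint δ y ∈ Ω := meshDomain_subset_meshVertices Ω δ hyD
    have hyU : meshPoint δ y ∉ closure (Ω \ Ω') := hseg (right_mem_segment ℝ _ _)
    have hyv : y ∈ meshVertices Ω' δ := by
      rw [mem_meshVertices_iff]
      by_contra hy'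
      exact hyU (subset_closure ⟨hyΩ, hy'⟩)
    have hxv : x ∈ meshVertices Ω' δ := meshDomain_subset_meshVertices Ω' δ hx
    -- hence a vertex of `Ω'_δ`, in the mesh component of `x`
    have hadj' : (meshVertexGraph Ω' δ).Adj ⟨x, hxv⟩ ⟨y, hyv⟩ := by
      show (meshGraph Ω' δ).Adj x y
      exact hmesh'
    have hy : y ∈ meshDomain Ω' δ :=
      mem_meshDomain_of_reachable_meshVertexGraph hx hxv hyv hadj'.reachable
    have hadjD : (discreteDomainGraph Ω' δ).Adj x y :=
      discreteDomainGraph_adj_iff.2 ⟨hmesh', hx, hy⟩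
    intro e he
    rw [SimpleGraph.Walk.edges_cons, List.mem_cons] at he
    rcases he with rfl | he
    · exact hadjD
    · exact ih hy hq e he

/-- **(B) The lattice lemma.** A self-avoiding walk of `Ω_δ` from `u` to `v` whose polyline class
stays off `cl (Ω ∖ Ω')` (the curve-space event `rangeSubset (cl (Ω ∖ Ω'))ᶜ`) is, with the same
support, a self-avoiding walk of `Ω'_δ`, provided `u` and `v` are joined in `Ω'_δ` (if `u = v`
the walk is trivial; otherwise `u ∈ Ω'_δ` and `forall_mem_edges_mem_edgeSet` applies; then
`SimpleGraph.Walk.transfer`). [folklore] -/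
theorem ConfinementCalib.exists_domainSAW_of_curve_mem_rangeSubset {u v : Site 2}
    (hreach : (discreteDomainGraph Ω' δ).Reachable u v) (γ : SAW.DomainSAW Ω δ u v)
    (hγ : γ.curve ∈ CurveClass.rangeSubset (closure (Ω \ Ω'))ᶜ) :
    ∃ γ' : SAW.DomainSAW Ω' δ u v, γ'.walk.support = γ.walk.support := by
  have hr : Set.range (γ.walk.toCurve (meshPoint δ)) ⊆ (closure (Ω \ Ω'))ᶜ := hγ
  suffices hE : ∀ e ∈ γ.walk.edges, e ∈ (discreteDomainGraph Ω' δ).edgeSet from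
    ⟨⟨γ.walk.transfer _ hE, γ.isPath.transfer hE⟩, γ.walk.support_transfer hE⟩
  by_cases huv : u = v
  · subst huv
    have hnil : γ.walk = SimpleGraph.Walk.nil :=
      SimpleGraph.Walk.eq_nil_iff_nil.2 (SimpleGraph.Walk.isPath_iff_nil.1 γ.isPath)
    intro e he
    rw [hnil] at he
    simp at he
  · exact ConfinementCalib.forall_mem_edges_mem_edgeSet γ.walk
      (ConfinementCalib.mem_meshDomain_of_reachable_of_ne hreach huv) hr

end Lattice

/-! ### (A) The marked points lie off `cl (D ∖ D')` -/

/-- If `s ∩ B(p, d) ⊆ t` with `d > 0`, then `p ∉ cl (s ∖ t)`: the open ball is a neighbourhood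
of `p` disjoint from `s ∖ t`. [folklore] -/
theorem ConfinementCalib.notMem_closure_diff_of_inter_ball_subset {p : ℂ} {d : ℝ} {s t : Set ℂ}
    (hd : 0 < d) (h : s ∩ ball p d ⊆ t) : p ∉ closure (s \ t) := by
  intro hmem
  rw [mem_closure_iff_nhds] at hmem
  obtain ⟨z, hzball, hzs, hzt⟩ := hmem (ball p d) (ball_mem_nhds _ hd)
  exact hzt (h ⟨hzs, hzball⟩)

/-! ### (D) The weak limit is a probability measure -/

/-- Under an endpoint approximation, a weak limit (`TendstoLaw`) of the critical SAW laws is the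
push-forward of a PROBABILITY measure: the SAW laws are probability measures for all small `δ`
(`eventually_isProbabilityMeasure_law`), so testing against `f ≡ 1` pins the total mass of the
limit to `1`. [folklore] -/
theorem ConfinementCalib.isProbabilityMeasure_map_of_tendstoLaw {D : DobrushinDomain}
    {a b : ℝ → Site 2} (hab : SAW.IsEndpointApprox D a b) {Ω₀ : Type*} [MeasurableSpace Ω₀]
    {Γ : Ω₀ → CurveClass ℂ} {P' : Measure Ω₀} (hΓ : AEMeasurable Γ P')
    (hT : TendstoLaw (fun δ (γ : SAW.DomainSAW D.carrier δ (a δ) (b δ)) => γ.curve)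
      (fun δ => SAW.law D.carrier δ (a δ) (b δ)) Γ P') :
    IsProbabilityMeasure (P'.map Γ) := by
  have hev := SubseqIdentification.Negative.eventually_isProbabilityMeasure_law hab
  have h1 := hT 1
  simp only [BoundedContinuousFunction.coe_one, Pi.one_apply, integral_const, smul_eq_mul,
    mul_one] at h1
  have h2 : Tendsto (fun δ => (SAW.law D.carrier δ (a δ) (b δ)).real univ) (𝓝[>] (0 : ℝ))
      (𝓝 1) :=
    tendsto_const_nhds.congr' (hev.mono fun δ hδ => by
      haveI := hδ
      exact probReal_univ.symm)
  have h3 : P'.real univ = 1 := tendsto_nhds_unique h1 h2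
  rw [measureReal_def, ENNReal.toReal_eq_one_iff] at h3
  haveI : IsProbabilityMeasure P' := ⟨h3⟩
  exact Measure.isProbabilityMeasure_map hΓ

/-! ### The registered calibration theorem -/

/-- **Calibration of STUB E (`confinementPositivity_of_scalingLimit`).** Confinement positivity
(the registered statement `stub_confinementPositivity`, verbatim as the conclusion) FOLLOWS from
the summit conjunct `SAWScalingLimit` together with the positivity of hull avoidance for the
chordal SLE_{8/3} law — for Dobrushin domains `D' ⊆ D` with the same marked points lying off
`cl (D ∖ D')`, every SLE_{8/3} law `μ` of `D` gives positive mass to the curves staying in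
`(cl (D ∖ D'))ᶜ` — both taken as HYPOTHESES.  Proof: (A) the socket condition puts the marked
points off `cl (D ∖ D')`; (C) the endpoint approximation of `D'` is one of `D`; (D) by
`SAWScalingLimit` the pushed SAW laws of `D` converge weakly to an SLE_{8/3} law `μ` (a
probability measure), so by the portmanteau inequality for the OPEN event
`G = rangeSubset (cl (D ∖ D'))ᶜ` the SAW probability of `{curve ∈ G}` exceeds `μ G / 2 > 0` for
all small `δ`; (B) on `{curve ∈ G}` the SAW is a `D'_δ`-walk.  See the module docstring.
[folklore] -/
theorem confinementPositivity_of_scalingLimit :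
    SAWScalingLimit →
    (∀ (D D' : DobrushinDomain) (μ : MeasureTheory.Measure (CurveClass ℂ)),
      D'.carrier ⊆ D.carrier → D'.pt 0 = D.pt 0 → D'.pt 1 = D.pt 1 →
      D.pt 0 ∉ closure (D.carrier \ D'.carrier) → D.pt 1 ∉ closure (D.carrier \ D'.carrier) →
      IsSLELaw ((8 : NNReal) / 3) D μ →
        0 < μ (CurveClass.rangeSubset ((closure (D.carrier \ D'.carrier))ᶜ))) →
    ∀ (D D' : DobrushinDomain) (a b : ℝ → Site 2) (d : ℝ), 0 < d →
      D'.carrier ⊆ D.carrier → D'.pt 0 = D.pt 0 → D'.pt 1 = D.pt 1 →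
      D.carrier ∩ (Metric.ball (D.pt 0) d ∪ Metric.ball (D.pt 1) d) ⊆ D'.carrier →
      SAW.IsEndpointApprox D' a b →
        ∃ c δ₀ : ℝ, 0 < c ∧ 0 < δ₀ ∧ ∀ δ ∈ Set.Ioc (0 : ℝ) δ₀,
          ENNReal.ofReal c ≤ SAW.law D.carrier δ (a δ) (b δ)
            {γ | ∃ γ' : SAW.DomainSAW D'.carrier δ (a δ) (b δ),
              γ'.walk.support = γ.walk.support} := by
  intro hSL hPos D D' a b d hd hsub h0 h1 hsock hab'
  classical
  -- (A) the marked points lie off `cl (D ∖ D')`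
  have hA0 : D.pt 0 ∉ closure (D.carrier \ D'.carrier) :=
    ConfinementCalib.notMem_closure_diff_of_inter_ball_subset hd
      fun z hz => hsock ⟨hz.1, Or.inl hz.2⟩
  have hA1 : D.pt 1 ∉ closure (D.carrier \ D'.carrier) :=
    ConfinementCalib.notMem_closure_diff_of_inter_ball_subset hd
      fun z hz => hsock ⟨hz.1, Or.inr hz.2⟩
  -- the open curve-space event
  have hGo : IsOpen (CurveClass.rangeSubset (closure (D.carrier \ D'.carrier))ᶜ) :=
    CurveClass.isOpen_rangeSubset isClosed_closure.isOpen_compl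
  have hGm : MeasurableSet (CurveClass.rangeSubset (closure (D.carrier \ D'.carrier))ᶜ) :=
    hGo.measurableSet
  -- (C) `(a_δ, b_δ)` is an endpoint approximation of `D` as well
  obtain ⟨δN, hδN, hnest⟩ :=
    D'.toJordanDomain.exists_forall_meshDomain_subset D.toJordanDomain hsub
  have hab : SAW.IsEndpointApprox D a b := by
    refine ⟨?_, ?_, ?_⟩
    · filter_upwards [hab'.reachable, Ioc_mem_nhdsGT hδN] with δ hr hδ
      obtain ⟨p⟩ := hr
      obtain ⟨γ, -⟩ := exists_domainSAW_of_meshDomain_subset hsub (hnest δ hδ.1 hδ.2)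
        (⟨p.bypass, p.bypass_isPath⟩ : SAW.DomainSAW D'.carrier δ (a δ) (b δ))
      exact γ.walk.reachable
    · rw [← h0]; exact hab'.tendsto_fst
    · rw [← h1]; exact hab'.tendsto_snd
  -- (D) the scaling limit: an SLE_{8/3} random curve `Γ`, its law `μ`, weak convergence
  obtain ⟨Γ, hΓ, -, hT⟩ := hSL D a b hab
  set μ : Measure (CurveClass ℂ) := Literature.Probability.Process.preWienerMeasure.map Γ with hμ
  have hμSLE : IsSLELaw ((8 : ℝ≥0) / 3) D μ := hΓ.isSLELaw_map
  have hpos : 0 < μ (CurveClass.rangeSubset (closure (D.carrier \ D'.carrier))ᶜ) :=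
    hPos D D' μ hsub h0 h1 hA0 hA1 hμSLE
  haveI hμP : IsProbabilityMeasure μ :=
    ConfinementCalib.isProbabilityMeasure_map_of_tendstoLaw hab hΓ.aemeasurable hT
  -- the SAW laws are probability measures for all small `δ`
  have hprob : ∀ᶠ δ in 𝓝[>] (0 : ℝ), IsProbabilityMeasure (SAW.law D.carrier δ (a δ) (b δ)) :=
    SubseqIdentification.Negative.eventually_isProbabilityMeasure_law hab
  -- surrogate family of probability laws on curve space, equal to the pushed SAW laws for
  -- small `δ`
  obtain ⟨ν, hν_of⟩ : ∃ ν : ℝ → ProbabilityMeasure (CurveClass ℂ), ∀ δ,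
      IsProbabilityMeasure (SAW.law D.carrier δ (a δ) (b δ)) →
        ((ν δ : ProbabilityMeasure (CurveClass ℂ)) : Measure (CurveClass ℂ)) =
          (SAW.law D.carrier δ (a δ) (b δ)).map (fun γ => γ.curve) := by
    refine ⟨fun δ => if h : IsProbabilityMeasure (SAW.law D.carrier δ (a δ) (b δ)) then
        (⟨(SAW.law D.carrier δ (a δ) (b δ)).map (fun γ => γ.curve), by
          haveI := h
          exact Measure.isProbabilityMeasure_map (SAW.aemeasurable_curve _ _ _ _)⟩ :
          ProbabilityMeasure (CurveClass ℂ))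
      else ⟨μ, hμP⟩, fun δ h => ?_⟩
    simp only [dif_pos h, ProbabilityMeasure.coe_mk]
  -- weak convergence of the surrogate family to the SLE law
  have hlim : Tendsto ν (𝓝[>] (0 : ℝ)) (𝓝 ⟨μ, hμP⟩) := by
    rw [ProbabilityMeasure.tendsto_iff_forall_integral_tendsto]
    intro f
    rw [ProbabilityMeasure.coe_mk, hμ,
      integral_map hΓ.aemeasurable f.continuous.aestronglyMeasurable]
    refine (hT f).congr' ?_
    filter_upwards [hprob] with δ hδ
    beta_reduce
    rw [hν_of δ hδ,
      integral_map (SAW.aemeasurable_curve _ _ _ _) f.continuous.aestronglyMeasurable]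
  -- portmanteau for the open event
  have hport : μ (CurveClass.rangeSubset (closure (D.carrier \ D'.carrier))ᶜ) ≤
      liminf (fun δ => ((ν δ : ProbabilityMeasure (CurveClass ℂ)) : Measure (CurveClass ℂ))
        (CurveClass.rangeSubset (closure (D.carrier \ D'.carrier))ᶜ)) (𝓝[>] (0 : ℝ)) :=
    ProbabilityMeasure.le_liminf_measure_open_of_tendsto hlim hGo
  -- half the limiting mass is eventually exceeded
  set m : ℝ≥0∞ := μ (CurveClass.rangeSubset (closure (D.carrier \ D'.carrier))ᶜ) with hm
  have hm0 : m ≠ 0 := hpos.ne'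
  have hmtop : m ≠ ⊤ := measure_ne_top _ _
  have hhalf : m / 2 < m := ENNReal.half_lt_self hm0 hmtop
  have hm2 : m / 2 ≠ 0 := (ENNReal.half_pos hm0).ne'
  have hm2top : m / 2 ≠ ⊤ := ne_top_of_lt hhalf
  have hev : ∀ᶠ δ in 𝓝[>] (0 : ℝ),
      m / 2 < ((ν δ : ProbabilityMeasure (CurveClass ℂ)) : Measure (CurveClass ℂ))
        (CurveClass.rangeSubset (closure (D.carrier \ D'.carrier))ᶜ) :=
    Filter.eventually_lt_of_lt_liminf (hhalf.trans_le hport)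
  -- on `{curve ∈ G}` the SAW is a `D'_δ`-walk (lattice lemma), for `δ` below the reachability
  -- threshold of the endpoint approximation of `D'`
  have hkey : ∀ᶠ δ in 𝓝[>] (0 : ℝ), m / 2 ≤ SAW.law D.carrier δ (a δ) (b δ)
      {γ | ∃ γ' : SAW.DomainSAW D'.carrier δ (a δ) (b δ),
        γ'.walk.support = γ.walk.support} := by
    filter_upwards [hev, hprob, hab'.reachable] with δ hlt hP hreach
    rw [hν_of δ hP, Measure.map_apply (SAW.DomainSAW.measurable_of_top _) hGm] at hlt
    refine hlt.le.trans (measure_mono ?_)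
    intro γ hγ
    exact ConfinementCalib.exists_domainSAW_of_curve_mem_rangeSubset hreach γ hγ
  -- constants
  obtain ⟨δ₂, hδ₂, hδ₂sub⟩ := (nhdsGT_basis (0 : ℝ)).eventually_iff.1 hkey
  refine ⟨(m / 2).toReal, δ₂ / 2, ENNReal.toReal_pos hm2 hm2top, half_pos hδ₂, fun δ hδ => ?_⟩
  have hδ' : δ ∈ Set.Ioo (0 : ℝ) δ₂ := ⟨hδ.1, hδ.2.trans_lt (half_lt_self hδ₂)⟩
  rw [ENNReal.ofReal_toReal hm2top]
  exact hδ₂sub hδ'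

end Summit.CriticalPhenomena.SAWScalingLimit.Theorems

end
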